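import Summits.BirchSwinnertonDyer.BirchSwinnertonDyer.Theses.ShaPrimaryTransfer
import Literature.NumberTheory.EllipticCurves.BSDSelmer
import Literature.NumberTheory.EllipticCurves.LeadingTerm
import Literature.NumberTheory.EllipticCurves.SelmerCorankHolds
import Literature.NumberTheory.EllipticCurves.IwasawaLeadingTermProofs
import Literature.NumberTheory.EllipticCurves.BSDpVariableChangeProofs

/-!
# BirchSwinnertonDyer / ShaPrimaryTransfer — crux `FiniteShaComponentTransfer` (stmt-BirchSwinnertonDyer-22356):
# the DOOR AT 3 (and at any odd good ordinary big-image prime) in rank 1 — Burungale–Skinner–Tian–Wan 2024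

The route names «2-descent / 3-descent / 4-descent» as its door instruments: O asks for SOME prime `p₀` with
`t_{p₀}(E) = corank_{ℤ_{p₀}} Ш(E)[p₀^∞] = 0`, «2 and 3 allowed». The companion `…Sectors` (g0) lists where a door
transfers in print in algebraic rank `≤ 1`: CM rank `0` at any prime (Burungale–Tian 2026) and good ordinary
`p ≥ 5` (BCS 2025 / Kim 2022 / Burungale–Tian 2020), leaving «rank ≤ 1 with the door at `p ∈ {2, 3}`» in the open
residue. For `p = 3` that residue is SMALLER than stated there: Burungale–Skinner–Tian–Wan, *Zeta elements for
elliptic curves and applications*, arXiv:2409.01350 (2024), Thm. 1.10, print the rank-one `p`-converse for EVERY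
ordinary `p ∤ 2N` — so `p = 3` INCLUDED — under (sur_ℚ) `ρ̄_{E,p}` surjective and (ram) a prime `ℓ ‖ N` at which
`ρ̄_{E,p}` ramifies (tree named fact `burungaleSkinnerTianWan_analyticRank_eq_one_of_selmerCorank_eq_one`,
bsd.S25, transcribed with (ram) in Tate-curve form: `ℓ` multiplicative, `p ∤ v_ℓ(Δ_min)`). This helper file
(prover seat `bsd-line-spt-p1` g2, `--supports stmt-22356 --as helper`) lands the corresponding sector of T:

* `transfer_of_rank_one_of_bstw` — rank `1`, door at an ODD good ordinary prime `p` with `ρ̄_{E,p}` surjective and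
  a (ram) prime: `t_p(E) = 0` makes `corank Sel_{p^∞} = 1` (Greenberg's identity, tree theorem), BSTW Thm. 1.10
  gives `ord_{s=1} L(E,s) = 1`, Gross–Zagier–Kolyvagin (`hGZK`) makes `Ш(E/ℚ)` finite, so every `t_q(E) = 0`.
* `transfer_doorAtThree_rank_one` — the case `p = 3`: complete 3-descent on a rank-1 curve, good ordinary at `3`
  with `ρ̄_{E,3}` surjective and some multiplicative `ℓ` with `3 ∤ v_ℓ(Δ_min)`, transfers to EVERY prime.
* `selmerCorank_eq_one_of_door_rank_one` / `transfer_of_selmerCorank_eq_one_of_bstw` — the same read directly on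
  `corank Sel_{p^∞} = 1` (what `p^∞`-descent outputs), where GZK also returns `rank = 1`, `t_p = 0`.

So, granting BSTW + GZK, what remains of T's rank-`≤ 1` residue at the door `3` is: rank `0` non-CM (no rank-zero
3-converse in the tree: BCS needs `p ≥ 5`), rank `1` with `ρ̄_{E,3}` not surjective or without a (ram) prime, and
curves supersingular or bad at `3` (e.g. Zywina's rank-2 family is multiplicative at `3`). CONDITIONAL on the
named facts; nothing here proves T or BSD.

References: A. Burungale, C. Skinner, Y. Tian, X. Wan, arXiv:2409.01350v2 (2024), Thm. 1.10 (p. 5); R. Greenberg,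
LNM 1716 (1999), §1 pp. 54–57; V. Kolyvagin (1990), Thm. A; B. Gross, D. Zagier, Invent. Math. 84 (1986).
-/

-- D-0017: single-problem summit, so `Summit.BirchSwinnertonDyer.BirchSwinnertonDyer.…` repeats a namespace BY DESIGN.
set_option linter.dupNamespace false

noncomputable section

namespace Summit.BirchSwinnertonDyer.BirchSwinnertonDyer.Theorems.ShaPrimaryTransferDoorAtThree

open scoped Classical
open Literature.NumberTheory.EllipticCurves
open WeierstrassCurve
open Summit.BirchSwinnertonDyer.BirchSwinnertonDyer.Theses.ShaPrimaryTransfer (FiniteShaComponentTransfer)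

/-- At a door prime of a rank-1 curve, `corank_{ℤ_p} Sel_{p^∞}(E/ℚ) = 1`: Greenberg's identity
`corank Sel_{p^∞} = rank + t_p` (tree theorem `selmerCorank_eq_mordellWeilRank_add_holds`) with `rank = 1`,
`t_p = 0`. Unconditional. [cite: Greenberg1999LNM, §1 pp. 54–57] -/
theorem selmerCorank_eq_one_of_door_rank_one (W : WeierstrassCurve ℚ) [W.IsElliptic] (p : ℕ) [Fact p.Prime]
    (hr : W.mordellWeilRank = 1) (h0 : W.shaCorank p = 0) : W.selmerCorank p = 1 := by
  rw [W.selmerCorank_eq_mordellWeilRank_add_holds p, hr, h0]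

/-- **Transfer from `corank Sel_{p^∞} = 1` at an odd good ordinary big-image prime (BSTW + GZK).** For `E/ℚ` on
a global minimal model, an ODD prime `p` of good ordinary reduction with `ρ̄_{E,p}` surjective and a multiplicative
prime `ℓ ≠ p` with `p ∤ v_ℓ(Δ_min)` ((ram): `ρ̄_{E,p}` ramified at `ℓ ‖ N`): `corank_{ℤ_p} Sel_{p^∞}(E/ℚ) = 1`
gives `ord_{s=1} L(E,s) = 1` (Burungale–Skinner–Tian–Wan 2024 Thm. 1.10, named fact `hBSTW`, `p = 3` allowed),
hence `Ш(E/ℚ)` finite and `rank E(ℚ) = 1` (Gross–Zagier–Kolyvagin, `hGZK`), hence `t_q(E) = 0` at EVERY prime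
`q` (and `t_p(E) = 0`: the corank-1 datum was a door). CONDITIONAL on `hBSTW`, `hGZK`.
[cite: BurungaleSkinnerTianWan2024, Thm. 1.10] [cite: Kolyvagin1990, Thm. A] -/
theorem transfer_of_selmerCorank_eq_one_of_bstw
    (hBSTW : burungaleSkinnerTianWan_analyticRank_eq_one_of_selmerCorank_eq_one)
    (hGZK : rank_eq_analyticRank_of_analyticRank_le_one)
    (W : WeierstrassCurve ℚ) [W.IsElliptic] [W.IsGloballyMinimal] (p q : ℕ) [Fact p.Prime] [Fact q.Prime]
    (hp2 : p ≠ 2) (hgood : W.HasGoodReductionAtPrime p) (hord : ¬ (p : ℤ) ∣ W.frobeniusTrace p)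
    (hsurj : W.HasSurjectiveModNGaloisRep p)
    (hram : ∃ ℓ : ℕ, ∃ _ : Fact ℓ.Prime, ℓ ≠ p ∧ W.HasMultiplicativeReductionAtPrime ℓ ∧
      ¬ p ∣ padicValInt ℓ W.minimalDiscriminantInt)
    (hs : W.selmerCorank p = 1) : W.mordellWeilRank = 1 ∧ W.shaCorank q = 0 := by
  have ha : W.analyticRank = 1 := hBSTW W p hp2 hgood hord hsurj hram hs
  obtain ⟨hr, hfin⟩ := hGZK W (by omega)
  haveI : Finite ↥W.sha := hfin
  exact ⟨by rw [hr, ha], W.shaCorank_eq_zero_of_finite q⟩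

/-- **Transfer in rank 1 from an odd good ordinary big-image door prime (BSTW + GZK).** For `E/ℚ` on a global
minimal model with `rank E(ℚ) = 1`, an ODD good ordinary `p` with `ρ̄_{E,p}` surjective, a (ram) prime `ℓ`, and
`t_p(E) = corank_{ℤ_p} Ш(E)[p^∞] = 0`: every `t_q(E)` vanishes. New relative to `…Sectors` exactly at `p = 3` (and in
trading «`E[p]` irreducible» for «`ρ̄_{E,p}` surjective + (ram)» at `p ≥ 5`). CONDITIONAL on `hBSTW`, `hGZK`.
[cite: BurungaleSkinnerTianWan2024, Thm. 1.10] [cite: Kolyvagin1990, Thm. A] -/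
theorem transfer_of_rank_one_of_bstw
    (hBSTW : burungaleSkinnerTianWan_analyticRank_eq_one_of_selmerCorank_eq_one)
    (hGZK : rank_eq_analyticRank_of_analyticRank_le_one)
    (W : WeierstrassCurve ℚ) [W.IsElliptic] [W.IsGloballyMinimal] (p q : ℕ) [Fact p.Prime] [Fact q.Prime]
    (hp2 : p ≠ 2) (hgood : W.HasGoodReductionAtPrime p) (hord : ¬ (p : ℤ) ∣ W.frobeniusTrace p)
    (hsurj : W.HasSurjectiveModNGaloisRep p)
    (hram : ∃ ℓ : ℕ, ∃ _ : Fact ℓ.Prime, ℓ ≠ p ∧ W.HasMultiplicativeReductionAtPrime ℓ ∧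
      ¬ p ∣ padicValInt ℓ W.minimalDiscriminantInt)
    (hr : W.mordellWeilRank = 1) (h0 : W.shaCorank p = 0) : W.shaCorank q = 0 :=
  (transfer_of_selmerCorank_eq_one_of_bstw hBSTW hGZK W p q hp2 hgood hord hsurj hram
    (selmerCorank_eq_one_of_door_rank_one W p hr h0)).2

/-- **The door at 3 transfers in rank 1 (BSTW + GZK).** For `E/ℚ` on a global minimal model with `rank E(ℚ) = 1`,
good ordinary reduction at `3`, `ρ̄_{E,3}` surjective, a multiplicative prime `ℓ` with `3 ∤ v_ℓ(Δ_min)`, and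
`t_3(E) = corank_{ℤ₃} Ш(E)[3^∞] = 0` (what complete 3-descent / 9-descent certifies): `t_q(E) = 0` at EVERY prime
`q`. CONDITIONAL on `hBSTW`, `hGZK`. [cite: BurungaleSkinnerTianWan2024, Thm. 1.10] [cite: Kolyvagin1990, Thm. A] -/
theorem transfer_doorAtThree_rank_one
    (hBSTW : burungaleSkinnerTianWan_analyticRank_eq_one_of_selmerCorank_eq_one)
    (hGZK : rank_eq_analyticRank_of_analyticRank_le_one)
    (W : WeierstrassCurve ℚ) [W.IsElliptic] [W.IsGloballyMinimal] (q : ℕ) [Fact q.Prime]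
    (hgood : W.HasGoodReductionAtPrime 3) (hord : ¬ ((3 : ℕ) : ℤ) ∣ W.frobeniusTrace 3)
    (hsurj : W.HasSurjectiveModNGaloisRep 3)
    (hram : ∃ ℓ : ℕ, ∃ _ : Fact ℓ.Prime, ℓ ≠ 3 ∧ W.HasMultiplicativeReductionAtPrime ℓ ∧
      ¬ 3 ∣ padicValInt ℓ W.minimalDiscriminantInt)
    (hr : W.mordellWeilRank = 1) (h0 : W.shaCorank 3 = 0) : W.shaCorank q = 0 :=
  haveI : Fact (Nat.Prime 3) := ⟨Nat.prime_three⟩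
  transfer_of_rank_one_of_bstw hBSTW hGZK W 3 q (by decide) hgood hord hsurj hram hr h0

/-- **The BSTW sector inside T.** Granting BSTW Thm. 1.10 and GZK, `FiniteShaComponentTransfer` is EQUIVALENT to
its restriction, on global minimal models, to door data `(E, p)` OFF the sector «rank `1`, `p` odd good ordinary,
`ρ̄_{E,p}` surjective, (ram)» (only the direction residue ⟹ T uses the facts; combine with
`ShaPrimaryTransferSectors.finiteShaComponentTransfer_iff_offSector_of_facts` for the full printed sector).
CONDITIONAL on `hBSTW`, `hGZK`. [cite: BurungaleSkinnerTianWan2024, Thm. 1.10] [cite: Kolyvagin1990, Thm. A] -/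
theorem finiteShaComponentTransfer_iff_offBSTWSector
    (hBSTW : burungaleSkinnerTianWan_analyticRank_eq_one_of_selmerCorank_eq_one)
    (hGZK : rank_eq_analyticRank_of_analyticRank_le_one) :
    FiniteShaComponentTransfer ↔
      ∀ (W : WeierstrassCurve ℚ) [W.IsElliptic] [W.IsGloballyMinimal] (p q : ℕ) [Fact p.Prime] [Fact q.Prime],
        ¬ (W.mordellWeilRank = 1 ∧ p ≠ 2 ∧ W.HasGoodReductionAtPrime p ∧ ¬ (p : ℤ) ∣ W.frobeniusTrace p ∧
            W.HasSurjectiveModNGaloisRep p ∧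
            ∃ ℓ : ℕ, ∃ _ : Fact ℓ.Prime, ℓ ≠ p ∧ W.HasMultiplicativeReductionAtPrime ℓ ∧
              ¬ p ∣ padicValInt ℓ W.minimalDiscriminantInt) →
        W.shaCorank p = 0 → W.shaCorank q = 0 := by
  constructor
  · intro hT W _ _ p q _ _ _ h0
    exact hT W p q h0
  · intro h W _ p q _ _ h0
    -- reduce to a global minimal model `C • W` (`t_p = 0` is an isomorphism invariant)
    obtain ⟨C, hC⟩ := hasGlobalMinimalModel_rat_holds W
    have hp' : (C • W).shaCorank p = 0 := by
      rw [← finite_primaryComponent_sha_iff_shaCorank_eq_zero (C • W) p,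
        finite_primaryComponent_sha_variableChange_iff W C p, finite_primaryComponent_sha_iff_shaCorank_eq_zero W p]
      exact h0
    have hq' : (C • W).shaCorank q = 0 := by
      by_cases hsec : (C • W).mordellWeilRank = 1 ∧ p ≠ 2 ∧ (C • W).HasGoodReductionAtPrime p ∧
          ¬ (p : ℤ) ∣ (C • W).frobeniusTrace p ∧ (C • W).HasSurjectiveModNGaloisRep p ∧
          ∃ ℓ : ℕ, ∃ _ : Fact ℓ.Prime, ℓ ≠ p ∧ (C • W).HasMultiplicativeReductionAtPrime ℓ ∧
            ¬ p ∣ padicValInt ℓ (C • W).minimalDiscriminantInt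
      · obtain ⟨hr, hp2, hgood, hord, hsurj, hram⟩ := hsec
        exact transfer_of_rank_one_of_bstw hBSTW hGZK (C • W) p q hp2 hgood hord hsurj hram hr hp'
      · exact h (C • W) p q hsec hp'
    rw [← finite_primaryComponent_sha_iff_shaCorank_eq_zero W q, ← finite_primaryComponent_sha_variableChange_iff W C q,
      finite_primaryComponent_sha_iff_shaCorank_eq_zero (C • W) q]
    exact hq'

end Summit.BirchSwinnertonDyer.BirchSwinnertonDyer.Theorems.ShaPrimaryTransferDoorAtThree
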